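import Summits.BirchSwinnertonDyer.Rank1Residual.X1.TamagawaSqueeze
import Literature.NumberTheory.EllipticCurves.KunduRay2024.TamagawaGeneratorBound
import HarnessLib

/-!
# Route T at layer 0, CITED: Kundu–Ray 2024 Lemma 6.3 supplies `λ_alg ≥ #{ℓ : p ∣ c_ℓ} + 1` at the
# `μ = 0` member of a leaf class WITHOUT rational `p`-torsion; the parity squeeze closes `BSD(E,p)`

HONEST FRAMING (cell `b2b-bsdres`, run/shared/lean/b2b/bsd-rank1-residual/, verbatim in every
file): the goal of the cell is to DELETE the COMBINATION-SHAPED residual classes of the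
Birch–Swinnerton-Dyer formula for ALL analytic-rank `≤ 1` elliptic curves over `ℚ` — "full BSD
formula for every rank `≤ 1` curve in class `C`" assembled STRICTLY from published theorems — so
that the rank-`≤ 1` remainder becomes exactly the CONSTRUCTION-SHAPED classes, which are TYPED
(missing-input `Prop`s), NOT attempted. This is not "finishing BSD". Sub-cell
`b2b-bsdres-eisenstein-p1` (CLASS-OWNERS row "X1 (r=0)"), gen 7: research route; NO CLAIM BEYOND
STATED CLASSES; nothing here changes a label. NO definitions; theorems over PUBLISHED named facts
(Kundu–Ray 2024 Lemma 6.3, Wuthrich 2014 Thm. 16, Greenberg LNM 1716 Prop. 3.10 and Thm. 4.1,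
modularity, Gross–Zagier–Kolyvagin) and the cell's per-pair certificates `AnalyticMuLE W p 0`,
`AnalyticLambdaEq W p n` and a finite set `S` of primes `ℓ ≠ p` with `p ∣ c_ℓ(E)`.

WHY THIS FILE. Route T (`X1/TamagawaSqueeze.lean`, gen 6) closes Mazur's main conjecture on the leaf
from a LOWER bound `λ_alg ≥ k` with `λ_an ≤ k + 1`; the bound was a TYPED input
(`AlgebraicLambdaGE`), justified outside the kernel by Greenberg's Cor. 5.6 mechanism over the
layers `ℚ_m` (X1R0-GAPMAP §14.1). Its LAYER-0 case at a member with `E(ℚ)[p] = 0` is IN PRINT: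
Kundu–Ray, IJNT 20 (2024), Lemma 6.3 — "`E` good ordinary at `p` [odd], `E(ℚ)[p] = 0`,
`Ш(E/ℚ)[p^∞]` finite ⇒ `λ_p + μ_p ≥ 𝔞 + 𝔟`", `𝔞 = #{ℓ ≠ p : p ∣ c_ℓ(E)}`, `𝔟 = [p ∣ #Ẽ(𝔽_p)]`
(`Literature/…/KunduRay2024/TamagawaGeneratorBound.lean`, named fact
`lem63_card_add_anomalous_le_lambda_add_mu`). On the leaf `𝔟 = 1` (anomalous), `μ = 0` at the
certified member (Kato–Wuthrich), `Ш` finite (Gross–Zagier–Kolyvagin at `r_an = 0`), so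
**`λ_alg ≥ #S + 1`** for every certified set `S` of Tamagawa-`p` primes, and the parity squeeze gives
Mazur's main conjecture and `BSD(E,p)` whenever `λ_an ≤ #S + 2` — with NO typed lower-bound input.
Scope: the leaf classes whose `μ = 0` member has no rational `p`-torsion (`φ ≠ 1`: 65 of 770 with
`N < 2·10⁴`, 1 026 more with `N < 5·10⁵`; all of `p = 13`); there route T's layer-0 closures (42 +
608 classes at `p = 3`, X1R0-GAPMAP §16.8) become compositions of published theorems. (At `φ = 1`
the `μ = 0` member HAS rational `p`-torsion and Lemma 6.3 does not apply; route T stays typed there.)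

* `lambdaPartAt_of_tamagawaPrimes_of_even` — the λ-part from Lemma 6.3 + parity.
* `mazurMainConjecture_of_tamagawaPrimes_of_even` — with the μ-part at `μ_an = 0`.
* `Leaf.bsdp_of_muZero_of_tamagawaPrimes` — headline on the leaf:
  `#E(ℚ)[p^∞] = 1 ∧ μ_an = 0 ∧ λ_an = n ∧ (S : p ∣ c_ℓ ∀ ℓ ∈ S) ∧ n ≤ #S + 2 ⇒ BSD(E,p)`;
  `Leaf.bsdp_of_muZero_lamTwo_of_card_primaryComponent_eq_one` — `λ_an = 2`, `S = ∅`.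

References: [KunduRay2024] Lemma 2.1, Def. 6.2, Lemma 6.3; [GreenbergLNM1716] Prop. 3.10, Thm. 4.1;
[Wuthrich2014] Thm. 16; HOME/b2b-bsdres-eisenstein-p1/X1R0-GAPMAP.md §14, §16.9.
-/

noncomputable section

open scoped Classical MatrixGroups ModularForm

open PowerSeries CongruenceSubgroup WeierstrassCurve Literature.NumberTheory.EllipticCurves
  Literature.NumberTheory.EllipticCurves.ModularForms
  Literature.NumberTheory.EllipticCurves.Rank1Residual
  Literature.NumberTheory.EllipticCurves.Greenberg1999
  Literature.NumberTheory.EllipticCurves.KunduRay2024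
  Summit.BirchSwinnertonDyer.BirchSwinnertonDyer.Theorems.Rank1ResidualX1Defs
  Summit.BirchSwinnertonDyer.Rank1Residual.X1.MuLambda
  Summit.BirchSwinnertonDyer.Rank1Residual.X1.MuPart
  Summit.BirchSwinnertonDyer.Rank1Residual.X1.ParitySqueeze
  Summit.BirchSwinnertonDyer.Rank1Residual.X1.TamagawaSqueeze

set_option autoImplicit false

namespace Summit.BirchSwinnertonDyer.Rank1Residual.X1.TamagawaSqueezeCited

section Squeeze

variable {W : WeierstrassCurve ℚ} [W.IsElliptic] [W.IsGloballyMinimal] {p : ℕ} [Fact p.Prime]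

/-- **The cited lower bound at a `μ_an = 0` member: `#S + 1 ≤ λ(X(E/ℚ_∞))`.** `W/ℚ` globally
minimal elliptic, `p ≠ 2` good ordinary ANOMALOUS (`p ∣ #Ẽ(𝔽_p)`) with `E[p]` reducible,
`#E(ℚ)[p^∞] = 1`, `Ш(E/ℚ)` finite, `μ_an(E,p) = 0` (`AnalyticMuLE W p 0`, so `μ(X) = 0` by
Kato–Wuthrich, `MuPart.mu_eq_zero_of_analyticMuLE_zero`), and `S` a finite set of primes `ℓ ≠ p` with
`p ∣ c_ℓ(E)`: for the cyclotomic data and every dual datum, `#S + 1 ≤ λ(D.X)` (Kundu–Ray Lemma 6.3).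
[cite: KunduRay2024, Lemma 6.3] [cite: Wuthrich2014, Thm. 16 (p. 397)] -/
theorem card_succ_le_lambdaInvariant (hKR : lem63_card_add_anomalous_le_lambda_add_mu)
    (hW16 : Wuthrich2014.charIdeal_dvd_padicLFunction) (hmod : nonempty_modularParametrizationData)
    (hp : p ≠ 2) (hgood : W.HasGoodReductionAtPrime p) (hord : ¬ (p : ℤ) ∣ W.frobeniusTrace p)
    (hred : ¬ W.HasIrreducibleModPGaloisRep p) (hanom : p ∣ W.reductionPointCount p)
    (htors : Nat.card (AddCommGroup.primaryComponent W.toAffine.Point p) = 1)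
    (hsha : Finite W.sha) (hμ : AnalyticMuLE W p 0)
    {S : Finset ℕ} (hS : ∀ ℓ ∈ S, ℓ ≠ p ∧ PDvdTamagawaAt W p ℓ)
    {κ : ZpExtension ℚ p} {γ : Field.absoluteGaloisGroup ℚ}
    (hκ : κ.IsCyclotomic) (hγ : κ.IsTopGenerator γ) (hγ' : IsCyclotomicVariable p γ)
    (D : W.SelmerDualData κ γ) : D.IsTorsion ∧ S.card + 1 ≤ lambdaInvariant p D.X := by
  haveI : NeZero (W.conductorNorm ℤ) := ⟨(W.conductorNorm_pos_holds).ne'⟩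
  haveI : Module.Finite (IwasawaAlgebra p) D.X := D.module_finite_holds hγ
  obtain ⟨hX, -⟩ := isTorsion_and_exists_factorisation hW16 hmod hp hgood hord hred hκ hγ hγ' D
  have hmu : D.mu = 0 := mu_eq_zero_of_analyticMuLE_zero hW16 hmod hp hgood hord hred hμ hκ hγ hγ' D
  exact ⟨hX, lem63_card_add_anomalous_le_lambda_add_mu.card_succ_le_lambdaInvariant_of_mu_eq_zero
    hKR W p hp hgood hord htors hsha hanom hS hκ hγ D hX hmu⟩

/-- **Route T at layer 0, cited — λ-part with parity.** Hypotheses of `card_succ_le_lambdaInvariant`,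
plus `Sel_{p^∞}(E/ℚ)` finite (`λ(f_E)` even by Greenberg's Prop. 3.10, `h310`), `λ_an(E,p) = n`
even (`AnalyticLambdaEq W p n`) and `n ≤ #S + 2`: the λ-part `LambdaPartAt W p` holds
(`ϖ·L_p = ι(f_E·h)`, `λ(f_E) = λ(X) ≥ #S + 1 ≥ n − 1`, `λ(h) = n − λ(f_E)` even and `≤ 1`, so `0`).
[cite: KunduRay2024, Lemma 6.3] [cite: GreenbergLNM1716, Prop. 3.10] [cite: Wuthrich2014, Thm. 16 (p. 397)] -/
theorem lambdaPartAt_of_tamagawaPrimes_of_even (hKR : lem63_card_add_anomalous_le_lambda_add_mu)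
    (hW16 : Wuthrich2014.charIdeal_dvd_padicLFunction)
    (h310 : prop310_selmerCorank_mod_two_eq_lambdaInvariant)
    (hmod : nonempty_modularParametrizationData)
    (hp : p ≠ 2) (hgood : W.HasGoodReductionAtPrime p) (hord : ¬ (p : ℤ) ∣ W.frobeniusTrace p)
    (hred : ¬ W.HasIrreducibleModPGaloisRep p) (hanom : p ∣ W.reductionPointCount p)
    (htors : Nat.card (AddCommGroup.primaryComponent W.toAffine.Point p) = 1)
    (hsha : Finite W.sha) (hSel : Finite (W.selmerGroupPInfty p)) (hμ : AnalyticMuLE W p 0)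
    {S : Finset ℕ} (hS : ∀ ℓ ∈ S, ℓ ≠ p ∧ PDvdTamagawaAt W p ℓ)
    {n : ℕ} (hn : Even n) (hlam : AnalyticLambdaEq W p n) (hnS : n ≤ S.card + 2) :
    LambdaPartAt W p := by
  intro κ γ hκ hγ hγ' _ f hf ϖ hϖ D g h hchar hι
  haveI : Module.Finite (IwasawaAlgebra p) D.X := D.module_finite_holds hγ
  obtain ⟨hX, h3⟩ := card_succ_le_lambdaInvariant hKR hW16 hmod hp hgood hord hred hanom htors hsha
    hμ hS hκ hγ hγ' D
  have hgh : g * h ≠ 0 := mul_ne_zero_of_iota_eq hgood hord hf hϖ D hι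
  have hg : g ≠ 0 := fun h0 ↦ hgh (by rw [h0, zero_mul])
  have hh : h ≠ 0 := fun h0 ↦ hgh (by rw [h0, mul_zero])
  have h1 : lam (g * h) = n := hlam f hf ϖ hϖ (g * h) hι
  have h2 : lam g = lambdaInvariant p D.X := lam_generator_eq_lambdaInvariant D.X hX hg hchar
  have hcork : W.selmerCorank p = 0 := by
    haveI := hSel
    exact zpCorank_eq_zero_of_finite (W.selmerGroupPInfty p) p
  have heven : Even (lam g) := by
    rw [h2]
    exact prop310_selmerCorank_mod_two_eq_lambdaInvariant.even_lambdaInvariant_of_selmerCorank_eq_zero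
      h310 W p hp hκ hγ D hX hcork
  have hgh2 : Even (lam (g * h)) := by rw [h1]; exact hn
  rw [lam_mul hg hh] at h1 hgh2 ⊢
  obtain ⟨a, ha⟩ := heven
  obtain ⟨b, hb⟩ := hgh2
  omega

/-- **Route T at layer 0, cited — Mazur's main conjecture** (μ-part automatic at `μ_an = 0`,
`MuPart.muPartAt_of_analyticMuLE_zero`; λ-part `lambdaPartAt_of_tamagawaPrimes_of_even`).
[cite: KunduRay2024, Lemma 6.3] [cite: GreenbergLNM1716, Prop. 3.10] [cite: Wuthrich2014, Thm. 16 (p. 397)] -/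
theorem mazurMainConjecture_of_tamagawaPrimes_of_even
    (hKR : lem63_card_add_anomalous_le_lambda_add_mu)
    (hW16 : Wuthrich2014.charIdeal_dvd_padicLFunction)
    (h310 : prop310_selmerCorank_mod_two_eq_lambdaInvariant)
    (hmod : nonempty_modularParametrizationData)
    (hp : p ≠ 2) (hgood : W.HasGoodReductionAtPrime p) (hord : ¬ (p : ℤ) ∣ W.frobeniusTrace p)
    (hred : ¬ W.HasIrreducibleModPGaloisRep p) (hanom : p ∣ W.reductionPointCount p)
    (htors : Nat.card (AddCommGroup.primaryComponent W.toAffine.Point p) = 1)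
    (hsha : Finite W.sha) (hSel : Finite (W.selmerGroupPInfty p)) (hμ : AnalyticMuLE W p 0)
    {S : Finset ℕ} (hS : ∀ ℓ ∈ S, ℓ ≠ p ∧ PDvdTamagawaAt W p ℓ)
    {n : ℕ} (hn : Even n) (hlam : AnalyticLambdaEq W p n) (hnS : n ≤ S.card + 2) :
    MazurMainConjecture W p :=
  (mazurMainConjecture_iff_muPart_and_lambdaPart hW16 hp hgood hord hred).mpr
    ⟨muPartAt_of_analyticMuLE_zero hW16 hp hgood hord hred hμ,
      lambdaPartAt_of_tamagawaPrimes_of_even hKR hW16 h310 hmod hp hgood hord hred hanom htors hsha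
        hSel hμ hS hn hlam hnS⟩

end Squeeze

/-! ## On the leaf X1 ∩ {r = 0} -/

section Leaf

variable {W : WeierstrassCurve ℚ} [W.IsElliptic] [W.IsGloballyMinimal] {p : ℕ} [Fact p.Prime]

omit [W.IsElliptic] in
/-- On the leaf `p ∣ #Ẽ(𝔽_p)` (the pair is anomalous: `a_p ≡ 1 (mod p)`), from
`ParitySqueeze.Leaf.one_le_padicValNat_reductionPointCount`. [folklore] -/
theorem Leaf.dvd_reductionPointCount (hL : RankZero.Leaf W p) : p ∣ W.reductionPointCount p :=
  dvd_of_one_le_padicValNat (ParitySqueeze.Leaf.one_le_padicValNat_reductionPointCount hL)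

/-- **Route T at layer 0, CITED, on the leaf — headline: `BSD(E,p)`.** `W/ℚ` globally minimal
elliptic on the leaf X1 ∩ {r = 0} at `p`, with NO rational `p`-power torsion (`#E(ℚ)[p^∞] = 1` — the
`μ = 0` member of a `φ ≠ 1` class), `μ_an(E,p) = 0`, `λ_an(E,p) = n`, and a finite set `S` of primes
`ℓ ≠ p` with `p ∣ c_ℓ(E)` such that `n ≤ #S + 2`: then `BSD(E,p)`. Inputs: Kundu–Ray 2024 Lemma 6.3
(`λ + μ ≥ #S + 1`), Kato–Wuthrich (`μ = 0` from `μ_an = 0`; `λ_alg ≤ λ_an`), Greenberg Prop. 3.10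
(parity; `λ_an` even on the leaf by `ParitySqueeze.Leaf.even_of_analyticLambdaEq`), Gross–Zagier–
Kolyvagin (`Ш(E/ℚ)` finite, `Sel_{p^∞}(E/ℚ)` finite at `r_an = 0`), Greenberg Thm. 4.1 + modularity
(`MC ⟺ BSD(E,p)` on the leaf, `RankZero.Leaf.mazurMainConjecture_iff_bsdp`) — ALL PUBLISHED; the
certificates are the integers `n`, `#S` and `μ_an = 0`. Example: `31827c2@13` (no 13-torsion in the
class; `3 ∥ N` of type I₁₃, `S = {3}`, `λ_an = 4 ≤ 3`? no — `n = 4 ≤ #S + 2 = 3` fails; closes by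
route T at `a = 2`), `20618d@3`-type classes with two Tamagawa-3 primes and `λ_an = 4`.
[cite: KunduRay2024, Lemma 6.3] [cite: GreenbergLNM1716, Prop. 3.10 and Thm. 4.1]
[cite: Wuthrich2014, Thm. 16 (p. 397)] -/
theorem Leaf.bsdp_of_muZero_of_tamagawaPrimes (hKR : lem63_card_add_anomalous_le_lambda_add_mu)
    (hW16 : Wuthrich2014.charIdeal_dvd_padicLFunction) (hGr : greenberg_charValue_rankZero)
    (h310 : prop310_selmerCorank_mod_two_eq_lambdaInvariant)
    (hmod : nonempty_modularParametrizationData)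
    (hGZK : rank_eq_analyticRank_of_analyticRank_le_one) (hL : RankZero.Leaf W p)
    (htors : Nat.card (AddCommGroup.primaryComponent W.toAffine.Point p) = 1)
    (hμ0 : AnalyticMuLE W p 0) {S : Finset ℕ} (hS : ∀ ℓ ∈ S, ℓ ≠ p ∧ PDvdTamagawaAt W p ℓ)
    {n : ℕ} (hlam : AnalyticLambdaEq W p n) (hnS : n ≤ S.card + 2) : BSDp W p :=
  have hX := isClassX1_of_classX1 hL.classX1
  (RankZero.Leaf.mazurMainConjecture_iff_bsdp hW16 hGr hmod hGZK hL).mp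
    (mazurMainConjecture_of_tamagawaPrimes_of_even hKR hW16 h310 hmod hX.two_ne
      hX.hasGoodReductionAtPrime hX.not_dvd_frobeniusTrace hX.not_hasIrreducibleModPGaloisRep
      (Leaf.dvd_reductionPointCount hL) htors (hGZK W (hL.analyticRank_eq_zero.trans_le (Nat.zero_le 1))).2
      (TamagawaSqueeze.Leaf.finite_selmerGroupPInfty hmod hGZK hL) hμ0 hS
      (ParitySqueeze.Leaf.even_of_analyticLambdaEq hW16 hmod hL hlam) hlam hnS)

/-- **`λ_an = 2` at a `φ ≠ 1` class, cited and with NO Tamagawa datum** (`S = ∅`): on the leaf,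
`#E(ℚ)[p^∞] = 1 ∧ μ_an = 0 ∧ λ_an = 2 ⇒ BSD(E,p)` — route P's conclusion
(`ParitySqueeze.Leaf.bsdp_of_muZero_lamTwo_of_not_dvd_torsionOrder`) re-derived from Kundu–Ray's
anomalous term alone, without Greenberg's Thm. 4.1 inequality `hb`. [cite: KunduRay2024, Lemma 6.3]
[cite: GreenbergLNM1716, Prop. 3.10] [cite: Wuthrich2014, Thm. 16 (p. 397)] -/
theorem Leaf.bsdp_of_muZero_lamTwo_of_card_primaryComponent_eq_one
    (hKR : lem63_card_add_anomalous_le_lambda_add_mu)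
    (hW16 : Wuthrich2014.charIdeal_dvd_padicLFunction) (hGr : greenberg_charValue_rankZero)
    (h310 : prop310_selmerCorank_mod_two_eq_lambdaInvariant)
    (hmod : nonempty_modularParametrizationData)
    (hGZK : rank_eq_analyticRank_of_analyticRank_le_one) (hL : RankZero.Leaf W p)
    (htors : Nat.card (AddCommGroup.primaryComponent W.toAffine.Point p) = 1)
    (hμ0 : AnalyticMuLE W p 0) (hlam2 : AnalyticLambdaEq W p 2) : BSDp W p :=
  Leaf.bsdp_of_muZero_of_tamagawaPrimes hKR hW16 hGr h310 hmod hGZK hL htors hμ0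
    (S := ∅) (fun _ h ↦ absurd h (Finset.notMem_empty _)) hlam2 (by simp)

end Leaf

end Summit.BirchSwinnertonDyer.Rank1Residual.X1.TamagawaSqueezeCited

end
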